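import Summits.KontsevichZagierPeriods.KontsevichZagierPeriods.Theorems.SymplecticScissorsRealOnePeriodRelationsStubGreenOnSquare

/-!
# `RealOnePeriodRelations` (stmt-KontsevichZagierPeriods-10042), line `nash-retraction-thin-strip`:
# Green on the unit square with degenerate vertical sides (reshape-1 form of `stub_greenOnSquare`)

WORK LOG (stub-worker of lead seat r-0): the helper kit is
`Theorems/SymplecticScissorsRealOnePeriodRelationsGreenOnSquareHelpers1.lean` (reflection `t ↦ 1 − t`
as ONE rule-2 move, rule-1b antipodal pairs, edge representations, point-reflected Green data); the
registered four-edge stub `stub_greenOnSquare` (reshape 2 of the line) is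
`Theorems/SymplecticScissorsRealOnePeriodRelationsStubGreenOnSquare.lean`; this file derives the
two-edge form with degenerate vertical sides which the reshape-1 skeleton (`coherence_of`, thin
strip between two replacement paths) consumes verbatim. Nothing open.

Statement (`greenOnSquare_degenerate`): for typed Green data `(A, B, S)` on the unit square
`Q = [0,1]²` (`A, B` `ℚ`-semialgebraic and continuous on `Q`, `dS = A da + B db` on the open square)
with `B(0,·) = B(1,·) = 0` on `(0,1)`, the bottom and top edge representations agree modulo
`closure (domainAddRel ∪ integrandAddRel ∪ changeOfVariablesRel ∪ Green)` (written out; it is `M₁`):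
`[∫₀¹ A(t,0) dt] − [∫₀¹ A(t,1) dt] ∈ M₁`. Proof: the four-edge theorem with the zero representation
`[∫_{(0,1)} 0]` on both vertical edges, `[rB] + [0] − [rT] − [0] = [rB] − [rT]`.

References: M. Kontsevich, D. Zagier, *Periods* (2001), §1.2.
-/

noncomputable section

open Set MeasureTheory
open Literature.NumberTheory.Transcendental
open Summit.KontsevichZagierPeriods.SymplecticScissors.RealOnePeriodRelationsNegative
  (M₁ greenSet unitDom constRep₁ constRep₁_domain constRep₁_integrand)

namespace Summit.KontsevichZagierPeriods.SymplecticScissors.RealOnePeriodRelations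

/-- **Green on the unit square with degenerate vertical sides** (reshape-1 signature of the stub
`stub_greenOnSquare`, registered anchor `greenOnSquare_degenerate`). For typed Green data `(A, B, S)`
on the unit square `Q` (semialgebraic, continuous on `Q`, potential on the open square) with
`B(0,·) = B(1,·) = 0` on `(0,1)`, the bottom and top edge representations agree modulo `M₁`:
`[∫₀¹ A(t,0) dt] − [∫₀¹ A(t,1) dt] ∈ M₁` — the four-edge Green on the square (`stub_greenOnSquare`:
two typed triangle instances, rule 2 with `t ↦ 1 − t`, rule 1b) with the zero representation on the
two vertical edges. [cite: KontsevichZagier2001, §1.2] -/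
theorem greenOnSquare_degenerate : ∀ (A B S : (Fin 2 → ℝ) → ℝ), IsSemialgebraicFunOn ℚ {p : Fin 2 → ℝ | 0 ≤ p 0 ∧ p 0 ≤ 1 ∧ 0 ≤ p 1 ∧ p 1 ≤ 1} A → IsSemialgebraicFunOn ℚ {p : Fin 2 → ℝ | 0 ≤ p 0 ∧ p 0 ≤ 1 ∧ 0 ≤ p 1 ∧ p 1 ≤ 1} B → ContinuousOn A {p : Fin 2 → ℝ | 0 ≤ p 0 ∧ p 0 ≤ 1 ∧ 0 ≤ p 1 ∧ p 1 ≤ 1} → ContinuousOn B {p : Fin 2 → ℝ | 0 ≤ p 0 ∧ p 0 ≤ 1 ∧ 0 ≤ p 1 ∧ p 1 ≤ 1} → (∀ p : Fin 2 → ℝ, 0 < p 0 → p 0 < 1 → 0 < p 1 → p 1 < 1 → HasFDerivAt S (A p • ContinuousLinearMap.proj (R := ℝ) (φ := fun _ : Fin 2 => ℝ) 0 + B p • ContinuousLinearMap.proj (R := ℝ) (φ := fun _ : Fin 2 => ℝ) 1) p) → (∀ t ∈ Set.Ioo (0 : ℝ) 1, B ![0, t] = 0) → (∀ t ∈ Set.Ioo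 (0 : ℝ) 1, B ![1, t] = 0) → ∀ (rB rT : KZ.IntegralRep 1), rB.domain = {z | z 0 ∈ Set.Ioo (0 : ℝ) 1} → rT.domain = {z | z 0 ∈ Set.Ioo (0 : ℝ) 1} → (∀ z ∈ rB.domain, rB.integrand z = A ![z 0, 0]) → (∀ z ∈ rT.domain, rT.integrand z = A ![z 0, 1]) → KZ.of rB - KZ.of rT ∈ AddSubgroup.closure (KZ.domainAddRel ∪ KZ.integrandAddRel ∪ KZ.changeOfVariablesRel ∪ {g : KZ.FormalRep | ∃ (Δ : Set (Fin 2 → ℝ)) (A B S : (Fin 2 → ℝ) → ℝ) (r₀₁ r₁₂ r₀₂ : KZ.IntegralRep 1), Δ = {p | 0 ≤ p 0 ∧ 0 ≤ p 1 ∧ p 0 + p 1 ≤ 1} ∧ IsSemialgebraicFunOn ℚ Δ A ∧ IsSemialgebraicFunOn ℚ Δ B ∧ ContinuousOn A Δ ∧ ContinuousOn B Δ ∧ (∀ p : Fin 2 → ℝ, 0 < p 0 → 0 < p 1 → p 0 + p 1 < 1 → HasFDerivAt S (A p • ContinuousLinearMap.proj (R := ℝ) (φ := fun _ : Fin 2 =>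 ℝ) 0 + B p • ContinuousLinearMap.proj (R := ℝ) (φ := fun _ : Fin 2 => ℝ) 1) p) ∧ r₀₁.domain = {z | z 0 ∈ Set.Ioo 0 1} ∧ r₁₂.domain = {z | z 0 ∈ Set.Ioo 0 1} ∧ r₀₂.domain = {z | z 0 ∈ Set.Ioo 0 1} ∧ (∀ z ∈ r₀₁.domain, r₀₁.integrand z = A ![z 0, 0]) ∧ (∀ z ∈ r₁₂.domain, r₁₂.integrand z = B ![1 - z 0, z 0] - A ![1 - z 0, z 0]) ∧ (∀ z ∈ r₀₂.domain, r₀₂.integrand z = B ![0, z 0]) ∧ g = KZ.of r₀₁ + KZ.of r₁₂ - KZ.of r₀₂}) := by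
  intro A B S hA hB hAc hBc hS hleft hright rB rT hrB hrT hrBi hrTi
  have hR : ∀ z ∈ (constRep₁ 0).domain, (constRep₁ 0).integrand z = B ![1, z 0] := by
    intro z hz
    have ht : z 0 ∈ Ioo (0 : ℝ) 1 := hz
    simp [hright (z 0) ht]
  have hL : ∀ z ∈ (constRep₁ 0).domain, (constRep₁ 0).integrand z = B ![0, z 0] := by
    intro z hz
    have ht : z 0 ∈ Ioo (0 : ℝ) 1 := hz
    simp [hleft (z 0) ht]
  have h : KZ.of rB + KZ.of (constRep₁ 0) - KZ.of rT - KZ.of (constRep₁ 0) ∈ M₁ :=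
    stub_greenOnSquare A B S hA hB hAc hBc hS rB (constRep₁ 0) rT (constRep₁ 0) hrB rfl hrT rfl
      hrBi hR hrTi hL
  have e : KZ.of rB - KZ.of rT =
      KZ.of rB + KZ.of (constRep₁ 0) - KZ.of rT - KZ.of (constRep₁ 0) := by abel
  rw [e]
  exact h

end Summit.KontsevichZagierPeriods.SymplecticScissors.RealOnePeriodRelations

end
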